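import Summits.QuantumFields.BalabanUV.T4Continuum.Support.NE7MultiplierDensity
import Summits.QuantumFields.BalabanUV.T4Continuum.Support.NE7MultiplierAnnihilatesGaugeDirections
import Summits.QuantumFields.BalabanUV.T4Continuum.Support.NE3SmoothLiftW
import Summits.QuantumFields.BalabanUV.T4Continuum.Support.NE3FramePotBoundW
import HarnessLib

/-!
# NE7MultiplierTailLetter — THE LAGRANGE MULTIPLIER COMPOSED WITH ANY LINEARISED PARTIAL TOWER SEES ONLY THE STRAIGHT (DOUBLE-BAR) TOWER, AND IS `O(ε)` ON IT IN `ℓ¹`: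
# `Dm(0)[levelQ′ L N k W (res Y)] = Dm(0)[skewPR (res (Q̄_{k+1,W} Y))]` and `|Dm(0)[levelQ′ L N k W (res Y)]| ≤ 2·curl1C 4 L·ε·‖Q̄_{k+1,W} Y‖_{ℓ¹(periodBox N)}` for EVERY base `W` of the
# multi-level class whose `(k+1)`-fold average is the datum `V₀` (ROAD-G116 §6 (G3): the letter that bounds the INNER terms `i < j` of the multiplier-term series of
# ✓ `NE7ConstraintSecondDerivativeRecursion`, with `W = cavgIter (i+1) U♯`, `k = j − 1 − i`, `Y =` the one-step curvature `D²coord_{U_i}[ψ^{(i)}, ψ^{(i)}]` of ✓ `NE7OneStepConstraintCurvature`)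

Cell `pub-balaban`, rung (B)+1 sub-cell t4, lineage `b2b-balaban-t4-ne7b-p1` (row NE7b OWNER + CRUX PROVER; junction service for row NE7, ruling R-OWNER-149-1 (2)), generation 161.
Index `t4/b2b-balaban-t4-ne7b-p1/g161/INDEX.md`; memo `g161/records/SCOPING-G3.md`.  MECHANISM: row NE3's structure theorem of the linearised tower at a curved multi-level
small-field base, ✓ `NE3TangentCovariantTower.dirIter_eq_QbarIter_add_gaugeDir` (`D_W Y = Q̄_W Y + gaugeDir_{Ŵ}(F_W Y)`, `Ŵ = cavgIter (k+1) W`, `F_W Y` the accumulated frame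
potential — skew and `N`-periodic by ✓ `NE3SmoothLiftW.framePotW_skew` ∕ `framePotW_add_period`) and its gauge covariance ✓ `dirIter_gaugeDir`; the dictionary `levelQ′ = skewPR ∘ res ∘ dirIter`
(✓ `NE7MultiplierDensity.levelQ'_resDir_eq_skewPR_dirIter`); the multiplier ANNIHILATES coarse gauge directions at the datum (✓ `NE7MultiplierAnnihilatesGaugeDirections`) and has
`ℓ¹`-density `2·curl1C·ε` (✓ `NE7MultiplierDensity.multiplier_density_allData_uniform`).
WHAT ([folklore]; 0 def, 0 sorry):
* §1 (every `d`, every `U(n)`, `L ≥ 1`; `W` unitary, `(tower L N (k+1))`-periodic, `SmallField W x`, `LevelSmall d L k x`): **`levelQ'_resDir_gaugeDir_eq`** — fine gauge directions go to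
  coarse gauge directions: `levelQ′ L N k W (res (gaugeDir W λ)) = skewPR (res (gaugeDir Ŵ (λ ∘ (L^{k+1}·))))`; **`levelQ'_resDir_eq_QbarIter_add_gaugeDir`** —
  `levelQ′ L N k W (res Y) = skewPR (res (Q̄_{k+1,W} Y)) + skewPR (res (gaugeDir Ŵ (F_W Y)))`.
* §2 (`d = 4`, `L ≥ 2`; `∃ ε₀ > 0 ∀ 0 < ε ≤ ε₀ ∀ N ≥ 1 ∀ j`, EVERY unitary `N`-periodic datum `V₀`, every `k`, every base `W` of the class with `cavgIter L (k+1) W = V₀`):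
  **`multiplier_levelQ'_gaugeDir_eq_zero`** (`Dm(0)[levelQ′_k W (res (gaugeDir W λ))] = 0`) and **`multiplier_levelQ'_eq_QbarIter`** (`Dm(0)[levelQ′_k W (res Y)] = Dm(0)[skewPR (res (Q̄ Y))]`),
  `m = minAct 4 (sfClass 4 L N ε) L N (j+1) ∘ chart_{V₀}` — NO smallness of `V₀`, NO minimiser needed (symmetry only).
* §3 (`d = 4`, `L ≥ 2`; the frame of ✓ `NE7MultiplierDensity`: `∃ ε₀ ∀ ε ∀ N ∃ δ_V ∀ j ∀ V₀` small `∀ U♯` minimiser): **`abs_multiplier_levelQ'_le_dirL1_QbarIter`** —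
  `|Dm(0)[levelQ′ L N k W (res Y)]| ≤ 2·curl1C 4 L·ε·dirL1 (QbarIter L (k+1) W Y) (periodBox N)` for every `k`, every base `W` of the class with `cavgIter L (k+1) W = V₀`, every skew
  `(tower L N (k+1))`-periodic `Y`.
HONEST FRAMING (page 1): composition of landed kernel theorems; nothing of Bałaban's asserted; NOT (G) (what remains for the inner terms: the `ℓ¹` contraction of the straight tower
`Σ_{periodBox N}‖Q̄_{m,W} Y‖ ≤ θ^m·‖Y‖_{ℓ¹}` — row NE3's majorant tower ✓ `NE3QbarIterMajorant` summed over a period — and the level masses of the lifts on the road's slice); NOT NE7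
as a spine node, NOT NE3; row NE7b NOT PRINTED ∕ NOT PROVED; spine 0∕9; finite T⁴ rung (B)+1 — NOT infinite volume, NOT mass gap, NOT BetaPertH, NOT Clay.
-/

set_option autoImplicit false

open scoped BigOperators Matrix Matrix.Norms.L2Operator Topology
open NormedSpace Finset Set Filter Metric

namespace Summit.QuantumFields.BalabanUV.T4Continuum.NE7MultiplierTailLetter

open Literature.MathematicalPhysics.QuantumFieldTheory.Balaban1983to89
open B7Prop1Explicit B7Prop2Explicit MatrixLog UnitaryModel
open T4AveragingDeficitWall (IsUnitaryCfg IsSkewDir SmallField dirL1)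
open T4AveragingDeficitWallBoundary (IsPeriodicCfg periodBox)
open AveragingDeficitPeriodicCounting (IsPeriodicDir)
open AveragingDeficitTorusChart (TDir chart extDir resDir extDir_resDir)
open AveragingDeficitTwoLevelPrep (skewSub mem_skewSub skewPR skewPF skewPF_of_mem)
open AveragingDeficitMultiLevelPrep (tower cavgIter levelQ' LevelSmall natCast_tower_succ)
open AveragingDeficitMultiLevelBridge (tower_eq)
open MinimalActionSandwich (IsMinimiser minAct)
open MinimalActionRate (sfClass)
open NE3TangentCovariantTower (dirIter QbarIter framePotW dirIter_gaugeDir dirIter_eq_QbarIter_add_gaugeDir)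
open NE3SmoothRightInverseW (isSkewDir_QbarIter)
open NE3SmoothLiftW (framePotW_skew framePotW_add_period)
open NE3FramePotBoundW (isPeriodicDir_QbarIter)
open NE3HatInvCurlLetters (curl1C curl1C_nonneg)
open BlockAveragePushDirGauge (gaugeDir isPeriodicDir_gaugeDir)
open NE7MinimalOrbitDatumContinuity (thresholds)
open NE7MultiplierAnnihilatesGaugeDirections (fderiv_minAct_chart_gaugeDir_eq_zero)
open NE7MultiplierDensity (levelQ'_resDir_eq_skewPR_dirIter multiplier_density_allData_uniform)

noncomputable section

variable {d : ℕ} {n : Type} [Fintype n] [DecidableEq n]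

/-! ## §1 The linearised partial tower on gauge directions and its straight ∕ frame split, in the `levelQ′` currency -/

omit [Fintype n] [DecidableEq n] in
/-- `res` is additive. [folklore] -/
theorem resDir_add (N : ℕ) (φ ψ : Site d → Fin d → Matrix n n ℂ) : resDir (n := n) N (fun z κ => φ z κ + ψ z κ) = resDir N φ + resDir N ψ := rfl

/-- **FINE GAUGE DIRECTIONS GO TO COARSE GAUGE DIRECTIONS**: `levelQ′ L N k W (res (gaugeDir W λ)) = skewPR (res (gaugeDir (cavgIter L (k+1) W) (λ ∘ (L^{k+1}·))))` for `W` in row NE3-R2's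
multi-level class and `λ` skew `(tower L N (k+1))`-periodic (✓ `dirIter_gaugeDir`). [cite: Balaban1985Averaging, (45) p.24] -/
theorem levelQ'_resDir_gaugeDir_eq [Nonempty n] {L N : ℕ} [NeZero L] [NeZero N] (hL : 1 ≤ L) (k : ℕ)
    {W : Site d → Fin d → (Matrix n n ℂ)ˣ} {x : ℝ} (hWu : IsUnitaryCfg W) (hWP : IsPeriodicCfg W ((tower L N (k + 1) : ℕ) : ℤ))
    (hx : 0 ≤ x) (hs : LevelSmall d L k x) (hWx : SmallField W x) {lam : Site d → Matrix n n ℂ} (hlam : ∀ z, lam z ∈ skewAdjoint (Matrix n n ℂ))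
    (hlamP : ∀ (y : Site d) (i : Fin d), lam (y + ((tower L N (k + 1) : ℕ) : ℤ) • e i) = lam y) :
    levelQ' L N k W (resDir (L * tower L N k) (gaugeDir W lam))
      = skewPR (d := d) (n := n) N (resDir N (gaugeDir (cavgIter L (k + 1) W) (fun y => lam (((L : ℤ) ^ (k + 1)) • y)))) := by
  have hWP' : IsPeriodicCfg W ((L : ℤ) * (tower L N k : ℕ)) := by rw [← natCast_tower_succ]; exact hWP
  have hgP : IsPeriodicDir (gaugeDir W lam) ((L * tower L N k : ℕ) : ℤ) := isPeriodicDir_gaugeDir hWP hlamP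
  rw [levelQ'_resDir_eq_skewPR_dirIter hL k hWu hWP' hx hs hWx hgP, dirIter_gaugeDir hL k hWu hWP hx hs hWx hlam hlamP]

/-- **THE STRAIGHT ∕ FRAME SPLIT IN THE `levelQ′` CURRENCY**: `levelQ′ L N k W (res Y) = skewPR (res (Q̄_{k+1,W} Y)) + skewPR (res (gaugeDir (cavgIter L (k+1) W) (F_W Y)))`
(✓ `dirIter_eq_QbarIter_add_gaugeDir`). [cite: Balaban1985Averaging, (120) p.35] -/
theorem levelQ'_resDir_eq_QbarIter_add_gaugeDir [Nonempty n] {L N : ℕ} [NeZero L] [NeZero N] (hL : 1 ≤ L) (k : ℕ)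
    {W : Site d → Fin d → (Matrix n n ℂ)ˣ} {x : ℝ} (hWu : IsUnitaryCfg W) (hWP : IsPeriodicCfg W ((tower L N (k + 1) : ℕ) : ℤ))
    (hx : 0 ≤ x) (hs : LevelSmall d L k x) (hWx : SmallField W x) {Y : Site d → Fin d → Matrix n n ℂ} (hY : IsSkewDir Y)
    (hYP : IsPeriodicDir Y ((tower L N (k + 1) : ℕ) : ℤ)) :
    levelQ' L N k W (resDir (L * tower L N k) Y)
      = skewPR (d := d) (n := n) N (resDir N (QbarIter L (k + 1) W Y))
        + skewPR (d := d) (n := n) N (resDir N (gaugeDir (cavgIter L (k + 1) W) (framePotW L (k + 1) W Y))) := by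
  have hWP' : IsPeriodicCfg W ((L : ℤ) * (tower L N k : ℕ)) := by rw [← natCast_tower_succ]; exact hWP
  rw [levelQ'_resDir_eq_skewPR_dirIter hL k hWu hWP' hx hs hWx hYP, dirIter_eq_QbarIter_add_gaugeDir hL k hWu hWP hx hs hWx hY hYP,
    resDir_add, map_add]

/-! ## §2 At the datum of the road: the multiplier kills the frame part -/

/-- **THE MULTIPLIER KILLS FINE GAUGE DIRECTIONS PUSHED THROUGH ANY PARTIAL TOWER** (`d = 4`, every `U(n)`, `L ≥ 2`): `∃ ε₀ > 0 ∀ 0 < ε ≤ ε₀ ∀ N ≥ 1 ∀ j`, for EVERY unitary `N`-periodic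
datum `V₀`, every `k`, every base `W` (unitary, `(tower L N (k+1))`-periodic, `SmallField W x`, `0 ≤ x`, `LevelSmall 4 L k x`) with `cavgIter L (k+1) W = V₀`, and every skew
`(tower L N (k+1))`-periodic `λ`: `D(minAct_{j+1} ∘ chart_{V₀})(0)[levelQ′ L N k W (res (gaugeDir W λ))] = 0`. [folklore] -/
theorem multiplier_levelQ'_gaugeDir_eq_zero [Nonempty n] {L : ℕ} [NeZero L] (hL : 2 ≤ L) :
    ∃ ε₀ : ℝ, 0 < ε₀ ∧ ∀ ε : ℝ, 0 < ε → ε ≤ ε₀ → ∀ (N : ℕ) [NeZero N], 1 ≤ N → ∀ j : ℕ,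
        ∀ V₀ : Site 4 → Fin 4 → (Matrix n n ℂ)ˣ, IsUnitaryCfg V₀ → IsPeriodicCfg V₀ (N : ℤ) →
        ∀ (k : ℕ) (W : Site 4 → Fin 4 → (Matrix n n ℂ)ˣ) (x : ℝ), IsUnitaryCfg W → IsPeriodicCfg W ((tower L N (k + 1) : ℕ) : ℤ) → 0 ≤ x →
          LevelSmall 4 L k x → SmallField W x → cavgIter L (k + 1) W = V₀ →
        ∀ lam : Site 4 → Matrix n n ℂ, (∀ z, lam z ∈ skewAdjoint (Matrix n n ℂ)) →
          (∀ (y : Site 4) (i : Fin 4), lam (y + ((tower L N (k + 1) : ℕ) : ℤ) • e i) = lam y) →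
        fderiv ℝ (fun y : ↥(skewSub 4 n N) => minAct 4 (sfClass 4 L N ε) L N (j + 1) (chart (ContinuousLinearMap.id ℝ (Matrix n n ℂ)) N V₀ (y : TDir 4 n N))) 0
            (levelQ' L N k W (resDir (L * tower L N k) (gaugeDir W lam))) = 0 := by
  obtain ⟨ε₁, hε₁, T⟩ := thresholds (n := n) hL
  have hL1 : 1 ≤ L := le_trans (by norm_num) hL
  refine ⟨ε₁, hε₁, fun ε hε hεle N _ hN j V₀ hV₀u hV₀P k W x hWu hWP hx hs hWx htop lam hlam hlamP => ?_⟩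
  obtain ⟨-, -, hls, -⟩ := T ε hε hεle
  rw [levelQ'_resDir_gaugeDir_eq hL1 k hWu hWP hx hs hWx hlam hlamP, htop]
  refine fderiv_minAct_chart_gaugeDir_eq_zero hL1 hε.le j (hls j) hV₀u hV₀P (fun z => hlam _) fun y i => ?_
  have e : ((L : ℤ) ^ (k + 1)) • (y + (N : ℤ) • e i) = ((L : ℤ) ^ (k + 1)) • y + ((tower L N (k + 1) : ℕ) : ℤ) • e i := by
    rw [smul_add, smul_smul, tower_eq]; push_cast; ring_nf
  simp only [e, hlamP]

/-- **THE MULTIPLIER SEES ONLY THE STRAIGHT TOWER** (`d = 4`, every `U(n)`, `L ≥ 2`; same frame as `multiplier_levelQ'_gaugeDir_eq_zero`): for every skew `(tower L N (k+1))`-periodic `Y`,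
`D(minAct_{j+1} ∘ chart_{V₀})(0)[levelQ′ L N k W (res Y)] = D(minAct_{j+1} ∘ chart_{V₀})(0)[skewPR (res (QbarIter L (k+1) W Y))]`. [folklore] -/
theorem multiplier_levelQ'_eq_QbarIter [Nonempty n] {L : ℕ} [NeZero L] (hL : 2 ≤ L) :
    ∃ ε₀ : ℝ, 0 < ε₀ ∧ ∀ ε : ℝ, 0 < ε → ε ≤ ε₀ → ∀ (N : ℕ) [NeZero N], 1 ≤ N → ∀ j : ℕ,
        ∀ V₀ : Site 4 → Fin 4 → (Matrix n n ℂ)ˣ, IsUnitaryCfg V₀ → IsPeriodicCfg V₀ (N : ℤ) →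
        ∀ (k : ℕ) (W : Site 4 → Fin 4 → (Matrix n n ℂ)ˣ) (x : ℝ), IsUnitaryCfg W → IsPeriodicCfg W ((tower L N (k + 1) : ℕ) : ℤ) → 0 ≤ x →
          LevelSmall 4 L k x → SmallField W x → cavgIter L (k + 1) W = V₀ →
        ∀ Y : Site 4 → Fin 4 → Matrix n n ℂ, IsSkewDir Y → IsPeriodicDir Y ((tower L N (k + 1) : ℕ) : ℤ) →
        fderiv ℝ (fun y : ↥(skewSub 4 n N) => minAct 4 (sfClass 4 L N ε) L N (j + 1) (chart (ContinuousLinearMap.id ℝ (Matrix n n ℂ)) N V₀ (y : TDir 4 n N))) 0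
            (levelQ' L N k W (resDir (L * tower L N k) Y))
          = fderiv ℝ (fun y : ↥(skewSub 4 n N) => minAct 4 (sfClass 4 L N ε) L N (j + 1) (chart (ContinuousLinearMap.id ℝ (Matrix n n ℂ)) N V₀ (y : TDir 4 n N))) 0
            (skewPR (d := 4) (n := n) N (resDir N (QbarIter L (k + 1) W Y))) := by
  obtain ⟨ε₁, hε₁, T⟩ := thresholds (n := n) hL
  have hL1 : 1 ≤ L := le_trans (by norm_num) hL
  refine ⟨ε₁, hε₁, fun ε hε hεle N _ hN j V₀ hV₀u hV₀P k W x hWu hWP hx hs hWx htop Y hY hYP => ?_⟩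
  obtain ⟨-, -, hls, -⟩ := T ε hε hεle
  rw [levelQ'_resDir_eq_QbarIter_add_gaugeDir hL1 k hWu hWP hx hs hWx hY hYP, map_add, htop]
  have hF : ∀ z, framePotW L (k + 1) W Y z ∈ skewAdjoint (Matrix n n ℂ) := framePotW_skew hL1 k hWu hx hs hWx hY
  have hFP : ∀ (z : Site 4) (i : Fin 4), framePotW L (k + 1) W Y (z + (N : ℤ) • e i) = framePotW L (k + 1) W Y z := framePotW_add_period L k hWP hYP
  rw [fderiv_minAct_chart_gaugeDir_eq_zero hL1 hε.le j (hls j) hV₀u hV₀P hF hFP, add_zero]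

/-! ## §3 The tail letter: `O(ε)` in the `ℓ¹` norm of the straight tower -/

/-- **THE TAIL LETTER** (`d = 4`, every `U(n)`, `L ≥ 2`; the frame of ✓ `NE7MultiplierDensity.multiplier_density_allData_uniform`): `∃ ε₀ > 0 ∀ 0 < ε ≤ ε₀ ∀ N ≥ 1 ∃ δ_V > 0 ∀ j`, for every
unitary `N`-periodic `δ_V`-small `V₀`, every minimiser `U♯` over it, every `k`, every base `W` of the multi-level class with `cavgIter L (k+1) W = V₀`, every skew `(tower L N (k+1))`-periodic
`Y`: `|D(minAct_{j+1} ∘ chart_{V₀})(0)[levelQ′ L N k W (res Y)]| ≤ 2·curl1C 4 L·ε·dirL1 (QbarIter L (k+1) W Y) (periodBox N)`. [folklore] -/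
theorem abs_multiplier_levelQ'_le_dirL1_QbarIter [Nonempty n] {L : ℕ} [NeZero L] (hL : 2 ≤ L) :
    ∃ ε₀ : ℝ, 0 < ε₀ ∧ ∀ ε : ℝ, 0 < ε → ε ≤ ε₀ → ∀ (N : ℕ) [NeZero N], 1 ≤ N → ∃ δV : ℝ, 0 < δV ∧ ∀ j : ℕ,
        ∀ V₀ ∈ {V : Site 4 → Fin 4 → (Matrix n n ℂ)ˣ | IsUnitaryCfg V ∧ IsPeriodicCfg V (N : ℤ) ∧ SmallField V δV},
        ∀ Us : Site 4 → Fin 4 → (Matrix n n ℂ)ˣ, IsMinimiser 4 (sfClass 4 L N ε) L N (j + 1) V₀ Us →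
        ∀ (k : ℕ) (W : Site 4 → Fin 4 → (Matrix n n ℂ)ˣ) (x : ℝ), IsUnitaryCfg W → IsPeriodicCfg W ((tower L N (k + 1) : ℕ) : ℤ) → 0 ≤ x →
          LevelSmall 4 L k x → SmallField W x → cavgIter L (k + 1) W = V₀ →
        ∀ Y : Site 4 → Fin 4 → Matrix n n ℂ, IsSkewDir Y → IsPeriodicDir Y ((tower L N (k + 1) : ℕ) : ℤ) →
        |fderiv ℝ (fun y : ↥(skewSub 4 n N) => minAct 4 (sfClass 4 L N ε) L N (j + 1) (chart (ContinuousLinearMap.id ℝ (Matrix n n ℂ)) N V₀ (y : TDir 4 n N))) 0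
            (levelQ' L N k W (resDir (L * tower L N k) Y))|
          ≤ 2 * curl1C 4 L * ε * dirL1 (QbarIter L (k + 1) W Y) (periodBox (d := 4) N) := by
  obtain ⟨ε₁, hε₁, S⟩ := multiplier_levelQ'_eq_QbarIter (n := n) hL
  obtain ⟨ε₂, hε₂, D⟩ := multiplier_density_allData_uniform (n := n) hL
  have hL1 : 1 ≤ L := le_trans (by norm_num) hL
  refine ⟨min ε₁ ε₂, lt_min hε₁ hε₂, fun ε hε hεle N _ hN => ?_⟩
  obtain ⟨δV, hδV, D1⟩ := D ε hε (hεle.trans (min_le_right _ _)) N hN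
  refine ⟨δV, hδV, fun j V₀ hV₀ Us hUs k W x hWu hWP hx hs hWx htop Y hY hYP => ?_⟩
  obtain ⟨hV₀u, hV₀P, hV₀δ⟩ := hV₀
  rw [S ε hε (hεle.trans (min_le_left _ _)) N hN j V₀ hV₀u hV₀P k W x hWu hWP hx hs hWx htop Y hY hYP]
  have h := D1 j V₀ ⟨hV₀u, hV₀P, hV₀δ⟩ Us hUs (skewPR (d := 4) (n := n) N (resDir N (QbarIter L (k + 1) W Y)))
  -- the straight tower is skew and `N`-periodic, so the skew projection is the identity and `ext ∘ res = id`
  have hQs : IsSkewDir (QbarIter L (k + 1) W Y) := isSkewDir_QbarIter hL1 k hWu hx hs hWx hY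
  have hQP : IsPeriodicDir (QbarIter L (k + 1) W Y) (N : ℤ) := isPeriodicDir_QbarIter L N (k + 1) hWP hYP
  have hmem : resDir N (QbarIter L (k + 1) W Y) ∈ skewSub 4 n N := mem_skewSub.mpr fun _ _ => hQs _ _
  have hcoe : ((skewPR (d := 4) (n := n) N (resDir N (QbarIter L (k + 1) W Y)) : ↥(skewSub 4 n N)) : TDir 4 n N) = resDir N (QbarIter L (k + 1) W Y) :=
    skewPF_of_mem hmem
  rw [hcoe, extDir_resDir N hQP] at h
  exact h

end

end Summit.QuantumFields.BalabanUV.T4Continuum.NE7MultiplierTailLetter
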